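import Mathlib
import Summits.Ventures.PercRepro2.Defs
import Summits.Ventures.PercRepro2.Independence
import Summits.Ventures.PercRepro2.Harris
import Summits.Ventures.PercRepro2.Graph
import Summits.Ventures.PercRepro2.Exploration
import Summits.Ventures.PercRepro2.Events
import Summits.Ventures.PercRepro2.Induced
import Summits.Ventures.PercRepro2.R4Defs

/-!
# The `|A| = 2` ladder of R4+: ordered forms, PAX, (H2′), the star-attached root
(blind cell PercRepro2, typer-1; statements only)

On p1's objects (`R4Defs.lean`: `gqTerm`, `lossTerm`, `R4PlusTwo`, `rhoZero`, `H2`; `U = C(a₂)`),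
the lead's `proofs/LEAD-PROOFSHAPES.md` §8.7:

* `H2Ordered`, `R4PlusTwoOrdered` — (H2) and R4+ at `|A| = 2` for the minimiser `a₁ = a*`,
  i.e. under the conn-order hypothesis `P(a₁ ↔ b) ≤ P(a₂ ↔ b)` (FALSE without it, lead 15:15Z);
* `T2Nonneg` — the rung (i): `P(o, b ∈ U, a₁ ∉ U) ≥ ρ₀ · P(o ∈ U, a₁, b ∉ U)` under the order
  hypothesis (vdB–Kahn + odds monotonicity) — a THEOREM (p1, `R4Ladder2.lean`);
* `pax` — `PAX = P(o, b ∈ U, a₁ ∉ U) − P(o ∈ U, a₁, b ∉ U) · P(b ∈ U, a₁ ∉ U) / P(a₁, b ∉ U)`,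
  and `H2Prime` — (H2′): `LOSS(a₁) ≤ PAX`;
* `StarAttached ends o S` — every edge at `o` has its other endpoint in `S` (`N(o) ⊆ S`), and
  `StarTheorem` — §8.7 (9): `N(o) ⊆ {a₁, a₂, b}` ⇒ (H2′) under the order hypothesis.

STATUS (NEG-11, engine D12 + lead, 2026-08-22T16:20Z): **(H2′) and (H2) are FALSE in general**
even under the conn-order — witness `c7_00168` (edges 03 16 24 26 35 36 45 46 56), extreme
per-edge weights, `o = 2`, `A = {1, 4}`, `b = 5`, `a* = 1` a near-tie minimiser:
`PAX − LOSS ≈ −3.8·10⁻⁵`; with edge 24 at `47/64`, `T2 − LOSS ≈ −3.0·10⁻⁵` while R4+ holds there.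
The implications (H2′) ⟹ (H2) ⟹ R4+ and `T2Nonneg` remain theorems; the closures `*_all`
below are FALSE statements kept for the negative record (never assume them); the star-attached
case `StarTheorem` is still open as a theorem-grade special case. The surviving rungs are
(H3), (H3′), (H4) in `Rungs.lean`.
-/

namespace Summit.Ventures.PercRepro2

section Ladder

variable {V : Type*} {E : Type*} [Fintype E] [DecidableEq E] [Fintype V] [DecidableEq V]
  {R : Type*} [Field R] [LinearOrder R]

/-- The conn-order hypothesis: `a₁` is the `b`-distance minimiser of `{a₁, a₂}`. -/
def ConnOrder (p : E → R) (ends : E → Sym2 V) (a₁ a₂ b : V) : Prop :=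
  prob p (connEvent ends a₁ b) ≤ prob p (connEvent ends a₂ b)

/-- **(H2)_ordered**: (H2) for the minimiser `a₁ = a*`. FALSE in general (NEG-11). -/
def H2Ordered (p : E → R) (ends : E → Sym2 V) (o a₁ a₂ b : V) : Prop :=
  ConnOrder p ends a₁ a₂ b → H2 p ends o a₁ a₂ b

/-- **R4+ at `|A| = 2`, ordered**: `R4PlusTwo` for the minimiser `a₁ = a*`. -/
def R4PlusTwoOrdered (p : E → R) (ends : E → Sym2 V) (o a₁ a₂ b : V) : Prop :=
  ConnOrder p ends a₁ a₂ b → R4PlusTwo p ends o a₁ a₂ b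

/-- **Rung (i), `t2_nonneg`**: under the order hypothesis, with `U = C(a₂)`,
`P(o ∈ U, b ∈ U, a₁ ∉ U) ≥ ρ₀ · P(o ∈ U, a₁ ∉ U, b ∉ U)`. -/
def T2Nonneg (p : E → R) (ends : E → Sym2 V) (o a₁ a₂ b : V) : Prop :=
  ConnOrder p ends a₁ a₂ b →
    rhoZero p ends a₁ a₂ b * prob p (connEvent ends o a₂ ∩ avoidAll ends a₂ {a₁, b}) ≤
      prob p (connEvent ends o a₂ ∩ connEvent ends a₂ b ∩ (connEvent ends a₂ a₁)ᶜ)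

/-- `PAX = P(o ∈ U, b ∈ U, a₁ ∉ U) − P(o ∈ U, a₁, b ∉ U) · P(b ∈ U, a₁ ∉ U) / P(a₁, b ∉ U)`,
`U = C(a₂)` (the conditional-covariance form of the `|A| = 2` ladder, §8.7 (ii)). -/
noncomputable def pax (p : E → R) (ends : E → Sym2 V) (o a₁ a₂ b : V) : R :=
  prob p (connEvent ends o a₂ ∩ connEvent ends a₂ b ∩ (connEvent ends a₂ a₁)ᶜ) -
    prob p (connEvent ends o a₂ ∩ avoidAll ends a₂ {a₁, b}) *
      prob p (connEvent ends a₂ b ∩ (connEvent ends a₂ a₁)ᶜ) / prob p (avoidAll ends a₂ {a₁, b})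

/-- **(H2′)** (§8.7 (ii)): `LOSS(a₁) ≤ PAX`. FALSE in general (NEG-11: `PAX − LOSS ≈ −3.8·10⁻⁵`
at `c7_00168`); (H2′) ⟹ (H2) ⟹ R4+ remain theorems. -/
def H2Prime (p : E → R) (ends : E → Sym2 V) (o a₁ a₂ b : V) : Prop :=
  lossTerm p ends o a₁ a₂ b ≤ pax p ends o a₁ a₂ b

/-- **(H2′)_ordered**: (H2′) for the minimiser `a₁ = a*`. FALSE in general (NEG-11). -/
def H2PrimeOrdered (p : E → R) (ends : E → Sym2 V) (o a₁ a₂ b : V) : Prop :=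
  ConnOrder p ends a₁ a₂ b → H2Prime p ends o a₁ a₂ b

/-- `PAX ≥ 0`, the weaker rung (holds in every census; equality set = that of `PAX ≥ LOSS`). -/
def PaxNonneg (p : E → R) (ends : E → Sym2 V) (o a₁ a₂ b : V) : Prop :=
  ConnOrder p ends a₁ a₂ b → 0 ≤ pax p ends o a₁ a₂ b

end Ladder

section Star

variable {V : Type*} {E : Type*}

/-- `N(o) ⊆ S`: every edge at `o` has its other endpoint in `S` (loops at `o` allowed). -/
def StarAttached (ends : E → Sym2 V) (o : V) (S : Finset V) : Prop :=
  ∀ (e : E) (x y : V), ends e = s(x, y) → x = o → y = o ∨ y ∈ S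

variable [Fintype E] [DecidableEq E] [Fintype V] [DecidableEq V] {R : Type*} [Field R]
  [LinearOrder R]

/-- **Star-attached root theorem** (§8.7 (9), theorem-grade target): if `N(o) ⊆ {a₁, a₂, b}`
then (H2′) holds under the order hypothesis, for an arbitrary graph `G − o`. -/
def StarTheorem (p : E → R) (ends : E → Sym2 V) (o a₁ a₂ b : V) : Prop :=
  StarAttached ends o {a₁, a₂, b} → H2PrimeOrdered p ends o a₁ a₂ b

end Star

section Closures

variable (R : Type) [Field R] [LinearOrder R] [IsStrictOrderedRing R]

/-- (H2′) for every finite graph and every minimiser `a₁` (`o ∉ {a₁, a₂, b}`, `a₁ ≠ a₂`).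
FALSE (NEG-11) — negative record only. -/
def H2PrimeOrdered_all : Prop :=
  ∀ (V E : Type) [Fintype V] [DecidableEq V] [Fintype E] [DecidableEq E]
    (ends : E → Sym2 V) (p : E → R), IsProbVec p →
    ∀ o a₁ a₂ b : V, a₁ ≠ a₂ → o ≠ a₁ → o ≠ a₂ → o ≠ b → H2PrimeOrdered p ends o a₁ a₂ b

/-- (H2) for every finite graph and every minimiser `a₁`. FALSE (NEG-11) — negative record only. -/
def H2Ordered_all : Prop :=
  ∀ (V E : Type) [Fintype V] [DecidableEq V] [Fintype E] [DecidableEq E]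
    (ends : E → Sym2 V) (p : E → R), IsProbVec p →
    ∀ o a₁ a₂ b : V, a₁ ≠ a₂ → o ≠ a₁ → o ≠ a₂ → o ≠ b → H2Ordered p ends o a₁ a₂ b

/-- R4+ at `|A| = 2` for every finite graph and every minimiser `a₁`. -/
def R4PlusTwoOrdered_all : Prop :=
  ∀ (V E : Type) [Fintype V] [DecidableEq V] [Fintype E] [DecidableEq E]
    (ends : E → Sym2 V) (p : E → R), IsProbVec p →
    ∀ o a₁ a₂ b : V, a₁ ≠ a₂ → o ≠ a₁ → o ≠ a₂ → o ≠ b → R4PlusTwoOrdered p ends o a₁ a₂ b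

/-- The star-attached root theorem for every finite graph. -/
def StarTheorem_all : Prop :=
  ∀ (V E : Type) [Fintype V] [DecidableEq V] [Fintype E] [DecidableEq E]
    (ends : E → Sym2 V) (p : E → R), IsProbVec p →
    ∀ o a₁ a₂ b : V, a₁ ≠ a₂ → o ≠ a₁ → o ≠ a₂ → o ≠ b → StarTheorem p ends o a₁ a₂ b

end Closures

end Summit.Ventures.PercRepro2
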